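import Summits.Ventures.Crystal3D.Theorems.StickyWulffConstantCoaxialWallLawDebtTwinRowGen
import Summits.Ventures.Crystal3D.Theorems.StickyWulffConstantCoaxialWallLawPayerTwinTwoPlateRowA
import HarnessLib

/-!
# Debt 1 of the vicinal split FROM THE (A) TWIN CENSUS ROW, every version

HONEST FRAMING. Venture `Summits/Ventures/Crystal3D` (cell `crystal3d-full`), helper `--supports` the crux
`CoaxialWallLaw` of `route-Ventures-StickyWulffConstant` (REGISTERED line `WallLedgerF`).  Rung credit; F-C1 not
moved; CONDITIONAL on named facts.  `…DebtTwinRowGen` VERBATIM with `EndRowTwinHalfTurnA ver s_F` (`…EndRowDefsA`, the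
row with the predecessor clause (A), cf-p1 (xliii)) and the rung `coaxialTwoSlabAdhesion_general_twin_of_rowA`.

* **`coaxialTwoSlabAdhesionCoherentTwin_of_rowA`**.  WHAT THIS IS NOT: not the row; F-C1 not moved.
-/

noncomputable section

namespace Summit.Ventures.Crystal3D.Theorems

open Summit.Ventures.Crystal3D Finset
open Literature.MathematicalPhysics.StatisticalMechanics (fccStacking barlowStacking IsHaggSeq)
open scoped InnerProductSpace

section Row

variable (ver : WordVersion) {δ : ℝ} (hg : KissingGap δ) (hc : KissingClassification δ)
variable {sF : ℝ} (hsF : 0 < sF) (hsF' : sF ≤ 2 * Real.sqrt 6)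
include hg hc hsF hsF'

open scoped Classical in
/-- **Debt 1 from the (A) twin row at version `ver`.**  See the module docstring. -/
theorem coaxialTwoSlabAdhesionCoherentTwin_of_rowA (hrowW : EndRowTwinHalfTurnA ver sF) :
    CoaxialTwoSlabAdhesionCoherentTwin := by
  intro A₁ t₁ A₂ t₂ hcoax hne hS
  obtain ⟨-, ν, hν1, hmenu, hA₂, -⟩ := hS
  have htwin : A₁ '' fccStacking 1 (Real.sqrt (2 / 3)) ≠ A₂ '' fccStacking 1 (Real.sqrt (2 / 3)) := by
    rw [hA₂]; exact image_ne_twinFrame A₁ hν1 hmenu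
  obtain ⟨L, s₁, s₂, σ, σ', hσ, hσ', hsub₁, hsub₂⟩ := hcoax
  set e₃ : EuclideanSpace ℝ (Fin 3) := EuclideanSpace.single (2 : Fin 3) (1 : ℝ) with he₃
  have hRR : ∀ L' : EuclideanSpace ℝ (Fin 3) ≃ₗᵢ[ℝ] EuclideanSpace ℝ (Fin 3),
      ((ℝ ∙ e₃).reflection).trans (((ℝ ∙ e₃).reflection).trans L') = L' := fun L' =>
    LinearIsometryEquiv.ext fun x => by
      simp only [LinearIsometryEquiv.trans_apply, Submodule.reflection_reflection]
  have hrow : ∀ F : Bool → (EuclideanSpace ℝ (Fin 3) ≃ₗᵢ[ℝ] EuclideanSpace ℝ (Fin 3)),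
      (F false = L ∧ F true = ((ℝ ∙ e₃).reflection).trans L ∨
        F false = ((ℝ ∙ e₃).reflection).trans L ∧ F true = L) →
      LocalEndRowA ver sF ⟨F false, inPlaneRoots (F false) 1⟩ ⟨F true, inPlaneRoots (F true) (-1)⟩ := by
    rintro F (⟨h0, h1⟩ | ⟨h0, h1⟩)
    · rw [h0, h1]; exact hrowW L
    · have := hrowW (((ℝ ∙ e₃).reflection).trans L)
      rw [hRR] at this
      rw [h0, h1]; exact this
  obtain ⟨C, R₀, hR₀, hmain⟩ := coaxialTwoSlabAdhesion_general_twin_of_rowA ver hg hc A₁ t₁ A₂ t₂ L s₁ s₂ σ σ'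
    hσ hσ' hsub₁ hsub₂ htwin hsF hsF' hrow
  exact ⟨L, s₁, s₂, σ, σ', hσ, hσ', hsub₁, hsub₂, C, R₀, hR₀, hmain⟩

end Row

end Summit.Ventures.Crystal3D.Theorems

end
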